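import Literature.AnabelianGeometry.SemiGraphs.ProSigmaCompletionRestrictClosure
import Mathlib.GroupTheory.SemidirectProduct
import Mathlib.Data.ZMod.Basic
import HarnessLib

/-!
# Pro-`Σ` completions, V: cofinal `Σ`-traces for `Δ ⋊_φ ℤ` when the twist has `Σ`-power order on `Σ`-quotients

Companion of `ProSigmaCompletionRestrictClosure.lean` (part IV, `IsProSigmaCompletion.closure_map_of_cofinal`:
`ι|_Δ : Δ → closure ι(Δ)` is a pro-`Σ` completion as soon as the `Σ`-index normal subgroups of `Δ` are cofinal with
the traces of those of the ambient group).  Here the cofinality is PROVED for the fibre `inl : Δ → Δ ⋊_φ ℤ` of a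
semidirect product by `ℤ` — the shape `Γ_𝔾 ⋊_τ ℤ` of a DPSC-extension whose cyclic inertia acts through a Dehn twist
`τ` ([AbsTopII] Def 1.2 (ii); [SemiAnbd] Ex. 2.10) — under the ONE hypothesis «the twist has `Σ`-power order on
every `Σ`-quotient»: for every normal `N ⊴ Δ` of `Σ`-integer index some `Σ`-integer power `τ^m` is the identity
modulo `N`.

* `SemidirectCofinal.exists_normal_sigma_trace` — for such `N` there is a normal `M ⊴ Δ ⋊_φ ℤ` of `Σ`-integer
  index with `inl⁻¹(M) ⊆ N`: `M = {(n, t^a) : n ∈ N₀, m₀ ∣ a}` for the `τ`-stable core `N₀ = ⋂_{k<m} τ^{-k}(N)`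
  (normal, `Σ`-index, `τ^{±1}`-stable since `τ^m ≡ id mod N`) and a `Σ`-integer `m₀` with `τ^{m₀} ≡ id mod N₀`;
  `[Δ ⋊ ℤ : M] = [Δ : N₀] · m₀`;
* `SemidirectCofinal.isProSigmaCompletion_closure_inl` — hence for a pro-`Σ` completion `ι` of `Δ ⋊_φ ℤ` with
  profinite target, `ι ∘ inl : Δ → closure ι(inl Δ)` is a pro-`Σ` completion of `Δ`.
* `SemidirectCofinal.exists_normal_sigma_trace_inr` / `isProSigmaCompletion_closure_inr` — for the SECTION `inr`
  the cofinality is unconditional (`M = rightHom⁻¹(N)`), so `ι ∘ inr : ℤ → closure ι(inr ℤ)` is always a pro-`Σ`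
  completion of `ℤ` (the inertia part `T ≅ Ẑ^Σ` of a Dehn-twist extension).
Plain group theory; theorems only (the `τ`-core bookkeeping is `private`); nothing here takes a side on [IUTchIII] Cor. 3.12.
[cite: MochizukiSemiAnbd2006, Ex. 2.10 p.31]
-/

namespace Literature.AnabelianGeometry.SemiGraphs.SemiGraphOfAnabelioids.IsProSigmaCompletion

open Literature.AnabelianGeometry.Anabelioids Topology

namespace SemidirectCofinal

variable {Δ : Type*} [Group Δ] {Sigma : Set ℕ} (φ : Multiplicative ℤ →* MulAut Δ)

/-- `φ(g) = τ ^ g` for `τ := φ(1)`. [folklore] -/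
private theorem apply_eq_zpow (g : Multiplicative ℤ) :
    φ g = φ (Multiplicative.ofAdd 1) ^ (Multiplicative.toAdd g) := by
  rw [← map_zpow, ← ofAdd_zsmul, smul_eq_mul, mul_one, ofAdd_toAdd]

/-- If `σ x · x⁻¹ ∈ N` for all `x`, then `x ∈ N ↔ σ x ∈ N`. [folklore] -/
private theorem mem_iff_apply_mem_of_forall {σ : MulAut Δ} {N : Subgroup Δ} (h : ∀ x, σ x * x⁻¹ ∈ N) (x : Δ) :
    x ∈ N ↔ σ x ∈ N := by
  constructor
  · intro hx
    have := N.mul_mem (h x) hx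
    rwa [inv_mul_cancel_right] at this
  · intro hx
    have := N.mul_mem (N.inv_mem (h x)) hx
    rwa [mul_inv_rev, inv_inv, mul_assoc, inv_mul_cancel, mul_one] at this

/-- Membership in the `τ`-core `⋂_{k<m} τ^{-k}(N)` (defined by recursion on `m`). [folklore] -/
private theorem mem_core_iff (τ : MulAut Δ) (N : Subgroup Δ) (m : ℕ) (x : Δ) :
    x ∈ (Nat.rec (motive := fun _ => Subgroup Δ) ⊤
      (fun k S => S ⊓ N.comap (τ ^ k).toMonoidHom) m) ↔ ∀ k < m, (τ ^ k) x ∈ N := by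
  induction m with
  | zero => simp
  | succ m ih =>
    change x ∈ (Nat.rec (motive := fun _ => Subgroup Δ) ⊤ (fun k S => S ⊓ N.comap (τ ^ k).toMonoidHom) m) ⊓
      N.comap (τ ^ m).toMonoidHom ↔ _
    rw [Subgroup.mem_inf, ih, Subgroup.mem_comap]
    constructor
    · rintro ⟨h1, h2⟩ k hk
      rcases Nat.lt_succ_iff_lt_or_eq.mp hk with hk | rfl
      · exact h1 k hk
      · exact h2
    · intro h
      exact ⟨fun k hk => h k (Nat.lt_succ_of_lt hk), h m (Nat.lt_succ_self m)⟩

/-- The `τ`-core is normal. [folklore] -/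
private theorem core_normal (τ : MulAut Δ) (N : Subgroup Δ) [N.Normal] (m : ℕ) :
    (Nat.rec (motive := fun _ => Subgroup Δ) ⊤ (fun k S => S ⊓ N.comap (τ ^ k).toMonoidHom) m).Normal := by
  induction m with
  | zero => exact (inferInstance : (⊤ : Subgroup Δ).Normal)
  | succ m ih =>
    haveI := ih
    change ((Nat.rec (motive := fun _ => Subgroup Δ) ⊤ (fun k S => S ⊓ N.comap (τ ^ k).toMonoidHom) m) ⊓
      N.comap (τ ^ m).toMonoidHom).Normal
    infer_instance

/-- The `τ`-core has `Σ`-integer index if `N` does. [folklore] -/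
private theorem core_index (τ : MulAut Δ) (N : Subgroup Δ) [N.Normal] (hN : IsSigmaInteger Sigma N.index) (m : ℕ) :
    IsSigmaInteger Sigma
      (Nat.rec (motive := fun _ => Subgroup Δ) ⊤ (fun k S => S ⊓ N.comap (τ ^ k).toMonoidHom) m).index := by
  induction m with
  | zero =>
    change IsSigmaInteger Sigma (⊤ : Subgroup Δ).index
    rw [Subgroup.index_top]
    exact IsSigmaInteger.one Sigma
  | succ m ih =>
    haveI := core_normal τ N m
    change IsSigmaInteger Sigma (((Nat.rec (motive := fun _ => Subgroup Δ) ⊤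
      (fun k S => S ⊓ N.comap (τ ^ k).toMonoidHom) m) ⊓ N.comap (τ ^ m).toMonoidHom).index)
    refine IsSigmaInteger.index_inf ih ?_
    rw [Subgroup.index_comap_of_surjective N (f := (τ ^ m).toMonoidHom) (τ ^ m).surjective]
    exact hN

/-- **Cofinal `Σ`-traces in `Δ ⋊_φ ℤ`.**  If for every normal `N ⊴ Δ` of `Σ`-integer index some `Σ`-integer power
of `τ = φ(1)` is the identity modulo `N`, then every such `N` contains `inl⁻¹(M)` for a normal `M ⊴ Δ ⋊_φ ℤ` of
`Σ`-integer index. [cite: MochizukiSemiAnbd2006, Ex. 2.10 p.31] -/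
theorem exists_normal_sigma_trace
    (hφ : ∀ N : Subgroup Δ, N.Normal → IsSigmaInteger Sigma N.index →
      ∃ m : ℕ, IsSigmaInteger Sigma m ∧ ∀ x, (φ (Multiplicative.ofAdd (m : ℤ))) x * x⁻¹ ∈ N)
    (N : Subgroup Δ) [N.Normal] (hN : IsSigmaInteger Sigma N.index) :
    ∃ M : Subgroup (Δ ⋊[φ] Multiplicative ℤ), M.Normal ∧ IsSigmaInteger Sigma M.index ∧
      M.comap SemidirectProduct.inl ≤ N := by
  classical
  set τ : MulAut Δ := φ (Multiplicative.ofAdd 1) with hτ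
  have hφτ : ∀ g, φ g = τ ^ (Multiplicative.toAdd g) := apply_eq_zpow φ
  have hφn : ∀ n : ℤ, φ (Multiplicative.ofAdd n) = τ ^ n := fun n => by rw [hφτ]; rfl
  /- `τ^m ≡ id (mod N)` for a `Σ`-integer `m` -/
  obtain ⟨m, hm, hmN⟩ := hφ N inferInstance hN
  have hmN' : ∀ x, (τ ^ m) x * x⁻¹ ∈ N := fun x => by
    have := hmN x
    rwa [hφn, zpow_natCast] at this
  have hm0 : 0 < m := hm.1
  obtain ⟨m', hm'⟩ : ∃ m', m = m' + 1 := ⟨m - 1, by omega⟩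
  have hNm : ∀ x, x ∈ N ↔ (τ ^ m) x ∈ N := mem_iff_apply_mem_of_forall hmN'
  /- the `τ`-core `N₀ = ⋂_{k<m} τ^{-k} N`: normal, `Σ`-index, inside `N`, `τ^{±1}`-stable -/
  set N₀ : Subgroup Δ := Nat.rec (motive := fun _ => Subgroup Δ) ⊤
    (fun k S => S ⊓ N.comap (τ ^ k).toMonoidHom) m with hN₀
  have hmem₀ : ∀ x, x ∈ N₀ ↔ ∀ k < m, (τ ^ k) x ∈ N := mem_core_iff τ N m
  haveI hN₀n : N₀.Normal := core_normal τ N m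
  have hN₀i : IsSigmaInteger Sigma N₀.index := core_index τ N hN m
  have hN₀N : N₀ ≤ N := fun x hx => by simpa using (hmem₀ x).mp hx 0 hm0
  have hstab₁ : ∀ x, x ∈ N₀ → τ x ∈ N₀ := by
    intro x hx
    rw [hmem₀] at hx ⊢
    intro k hk
    rw [← MulAut.mul_apply, ← pow_succ]
    rcases Nat.lt_or_ge (k + 1) m with h1 | h1
    · exact hx _ h1
    · have hkm : k + 1 = m := le_antisymm hk h1
      rw [hkm]
      have h0 := hx 0 hm0
      rw [pow_zero, MulAut.one_apply] at h0
      exact (hNm x).mp h0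
  have hstab₂ : ∀ x, x ∈ N₀ → τ⁻¹ x ∈ N₀ := by
    intro x hx
    rw [hmem₀] at hx ⊢
    intro k hk
    rcases Nat.eq_zero_or_pos k with rfl | hk0
    · rw [pow_zero, MulAut.one_apply, hNm, hm', pow_succ, MulAut.mul_apply, MulAut.inv_def,
        MulEquiv.apply_symm_apply]
      exact hx m' (by omega)
    · obtain ⟨k', rfl⟩ : ∃ k', k = k' + 1 := ⟨k - 1, by omega⟩
      rw [pow_succ, MulAut.mul_apply, MulAut.inv_def, MulEquiv.apply_symm_apply]
      exact hx k' (by omega)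
  have hstabZ : ∀ (a : ℤ) (x : Δ), x ∈ N₀ → (τ ^ a) x ∈ N₀ := by
    intro a
    induction a using Int.induction_on with
    | zero => intro x hx; simpa using hx
    | succ a ih =>
      intro x hx
      rw [zpow_add_one, MulAut.mul_apply]
      exact ih _ (hstab₁ x hx)
    | pred a ih =>
      intro x hx
      rw [zpow_sub_one, MulAut.mul_apply]
      exact ih _ (hstab₂ x hx)
  /- `τ^{m₀} ≡ id (mod N₀)` for a `Σ`-integer `m₀`, hence `τ^{m₀ q} ≡ id (mod N₀)` for all `q ∈ ℤ` -/
  obtain ⟨m₀, hm₀, hm₀N⟩ := hφ N₀ hN₀n hN₀i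
  have hm₀N' : ∀ x, (τ ^ (m₀ : ℤ)) x * x⁻¹ ∈ N₀ := fun x => by
    have := hm₀N x
    rwa [hφn] at this
  have hB : ∀ (q : ℤ) (z : Δ), (τ ^ ((m₀ : ℤ) * q)) z * z⁻¹ ∈ N₀ := by
    intro q
    induction q using Int.induction_on with
    | zero => intro z; simp
    | succ q ih =>
      intro z
      have e : (τ ^ ((m₀ : ℤ) * (q + 1))) z * z⁻¹ =
          ((τ ^ ((m₀ : ℤ) * q)) ((τ ^ (m₀ : ℤ)) z) * ((τ ^ (m₀ : ℤ)) z)⁻¹) *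
            ((τ ^ (m₀ : ℤ)) z * z⁻¹) := by
        rw [mul_add, mul_one, zpow_add, MulAut.mul_apply]
        group
      rw [e]
      exact N₀.mul_mem (ih _) (hm₀N' z)
    | pred q ih =>
      intro z
      set y := (τ ^ (m₀ : ℤ))⁻¹ z with hy
      have hzy : z = (τ ^ (m₀ : ℤ)) y := by
        rw [hy, MulAut.inv_def, MulEquiv.apply_symm_apply]
      have e : (τ ^ ((m₀ : ℤ) * (-(q : ℤ) - 1))) z * z⁻¹ =
          ((τ ^ ((m₀ : ℤ) * -(q : ℤ))) y * y⁻¹) * ((τ ^ (m₀ : ℤ)) y * y⁻¹)⁻¹ := by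
        rw [mul_sub, mul_one, zpow_sub, MulAut.mul_apply, ← hy, hzy]
        group
      rw [e]
      exact N₀.mul_mem (ih _) (N₀.inv_mem (hm₀N' y))
  have hB' : ∀ (q : ℤ) (z : Δ), ((τ ^ ((m₀ : ℤ) * q)) z)⁻¹ * z ∈ N₀ := by
    intro q z
    have := hN₀n.conj_mem _ (N₀.inv_mem (hB q z)) z⁻¹
    simpa [mul_assoc] using this
  /- the subgroup `M = {(n, t^a) : n ∈ N₀, m₀ ∣ a}` -/
  let M : Subgroup (Δ ⋊[φ] Multiplicative ℤ) :=
    { carrier := {g | g.left ∈ N₀ ∧ (m₀ : ℤ) ∣ Multiplicative.toAdd g.right}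
      mul_mem' := by
        rintro a b ⟨ha1, ha2⟩ ⟨hb1, hb2⟩
        refine ⟨?_, ?_⟩
        · rw [SemidirectProduct.mul_left, hφτ]
          exact N₀.mul_mem ha1 (hstabZ _ _ hb1)
        · rw [SemidirectProduct.mul_right, toAdd_mul]
          exact dvd_add ha2 hb2
      one_mem' := ⟨by rw [SemidirectProduct.one_left]; exact N₀.one_mem, by simp⟩
      inv_mem' := by
        rintro a ⟨ha1, ha2⟩
        refine ⟨?_, ?_⟩
        · rw [SemidirectProduct.inv_left, hφτ]
          exact hstabZ _ _ (N₀.inv_mem ha1)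
        · rw [SemidirectProduct.inv_right, toAdd_inv]
          exact (dvd_neg).mpr ha2 }
  have hMmem : ∀ g, g ∈ M ↔ g.left ∈ N₀ ∧ (m₀ : ℤ) ∣ Multiplicative.toAdd g.right := fun _ => Iff.rfl
  have hright : ∀ x y : Δ ⋊[φ] Multiplicative ℤ, (y * x * y⁻¹).right = x.right := by
    intro x y
    rw [SemidirectProduct.mul_right, SemidirectProduct.mul_right, SemidirectProduct.inv_right,
      mul_comm y.right, mul_inv_cancel_right]
  have hMn : M.Normal := by
    refine ⟨fun x hx y => ?_⟩
    obtain ⟨hx1, ⟨q, hq⟩⟩ := (hMmem x).mp hx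
    refine (hMmem _).mpr ⟨?_, ?_⟩
    · have hL : (y * x * y⁻¹).left =
          (y.left * (φ y.right) x.left * y.left⁻¹) * (y.left * (τ ^ ((m₀ : ℤ) * q)) y.left⁻¹) := by
        rw [SemidirectProduct.mul_left, SemidirectProduct.mul_left, SemidirectProduct.inv_left,
          SemidirectProduct.mul_right, ← MulAut.mul_apply, ← map_mul,
          show y.right * x.right * y.right⁻¹ = x.right by rw [mul_comm y.right, mul_inv_cancel_right],
          hφτ x.right, hq]
        group
      rw [hL]
      refine N₀.mul_mem (hN₀n.conj_mem _ ?_ _) ?_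
      · rw [hφτ]
        exact hstabZ _ _ hx1
      · have := hN₀n.conj_mem _ (hB q y.left⁻¹) y.left
        simpa [mul_assoc] using this
    · rw [hright]
      exact ⟨q, hq⟩
  /- the index of `M`: `[Δ ⋊ ℤ : K] = m₀` for `K = {m₀ ∣ a}` and `[K : M] = [Δ : N₀]` -/
  haveI : NeZero m₀ := ⟨hm₀.1.ne'⟩
  let χ : (Δ ⋊[φ] Multiplicative ℤ) →* Multiplicative (ZMod m₀) :=
    (AddMonoidHom.toMultiplicative (Int.castAddHom (ZMod m₀))).comp SemidirectProduct.rightHom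
  have hχ : ∀ g, g ∈ χ.ker ↔ (m₀ : ℤ) ∣ Multiplicative.toAdd g.right := by
    intro g
    rw [MonoidHom.mem_ker]
    change Multiplicative.ofAdd (((Multiplicative.toAdd g.right : ℤ) : ZMod m₀)) = 1 ↔ _
    rw [← ofAdd_zero, Multiplicative.ofAdd.injective.eq_iff, ZMod.intCast_zmod_eq_zero_iff_dvd]
  have hχsurj : Function.Surjective χ := by
    intro c
    obtain ⟨z, hz⟩ := ZMod.intCast_surjective (Multiplicative.toAdd c)
    refine ⟨SemidirectProduct.inr (Multiplicative.ofAdd z), ?_⟩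
    change Multiplicative.ofAdd
      (((Multiplicative.toAdd (SemidirectProduct.rightHom
        (SemidirectProduct.inr (Multiplicative.ofAdd z) : Δ ⋊[φ] Multiplicative ℤ)) : ℤ) : ZMod m₀)) = c
    rw [SemidirectProduct.rightHom_inr, toAdd_ofAdd, hz, ofAdd_toAdd]
  have hKi : χ.ker.index = m₀ := by
    rw [Subgroup.index_ker, MonoidHom.range_eq_top.mpr hχsurj, Subgroup.card_top]
    exact Nat.card_zmod m₀
  have hMK : M ≤ χ.ker := fun g hg => (hχ g).mpr ((hMmem g).mp hg).2
  -- `K → Δ/N₀`, `k ↦ k.left`, is a surjective homomorphism with kernel `M ∩ K = M`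
  let ψ : ↥χ.ker →* Δ ⧸ N₀ :=
    { toFun := fun k => (((k : Δ ⋊[φ] Multiplicative ℤ).left : Δ) : Δ ⧸ N₀)
      map_one' := by
        show (((1 : Δ ⋊[φ] Multiplicative ℤ).left : Δ) : Δ ⧸ N₀) = 1
        rw [SemidirectProduct.one_left, QuotientGroup.mk_one]
      map_mul' := by
        rintro ⟨a, ha⟩ ⟨b, hb⟩
        obtain ⟨q, hq⟩ := (hχ a).mp ha
        show (((a * b).left : Δ) : Δ ⧸ N₀) = ((a.left : Δ) : Δ ⧸ N₀) * ((b.left : Δ) : Δ ⧸ N₀)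
        rw [← QuotientGroup.mk_mul, QuotientGroup.eq, SemidirectProduct.mul_left, hφτ, hq, mul_inv_rev,
          mul_assoc, inv_mul_cancel_left]
        exact hB' q b.left }
  have hψsurj : Function.Surjective ψ := by
    intro y
    obtain ⟨d, rfl⟩ := QuotientGroup.mk_surjective y
    refine ⟨⟨SemidirectProduct.inl d, (hχ _).mpr ?_⟩, rfl⟩
    rw [SemidirectProduct.right_inl, toAdd_one]
    exact dvd_zero _
  have hψker : M.subgroupOf χ.ker = ψ.ker := by
    ext k
    rw [Subgroup.mem_subgroupOf, MonoidHom.mem_ker, hMmem]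
    constructor
    · rintro ⟨h1, -⟩
      exact (QuotientGroup.eq_one_iff _).mpr h1
    · intro h
      exact ⟨(QuotientGroup.eq_one_iff _).mp h, (hχ _).mp k.2⟩
  have hrel : M.relIndex χ.ker = N₀.index := by
    show (M.subgroupOf χ.ker).index = N₀.index
    rw [hψker, Subgroup.index_ker, MonoidHom.range_eq_top.mpr hψsurj, Subgroup.card_top,
      ← Subgroup.index_eq_card]
  have hMi : IsSigmaInteger Sigma M.index := by
    rw [← Subgroup.relIndex_mul_index hMK, hrel, hKi]
    exact hN₀i.mul hm₀
  exact ⟨M, hMn, hMi, fun d hd => hN₀N ((hMmem _).mp hd).1⟩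

variable {P : Type*} [Group P] [TopologicalSpace P] [IsTopologicalGroup P] [CompactSpace P]
  [TotallyDisconnectedSpace P]

/-- **The fibre of `Δ ⋊_φ ℤ` is pro-`Σ` completed by closure**: if `ι : Δ ⋊_φ ℤ → P` is a pro-`Σ` completion
(`P` profinite) and the twist `φ(1)` has `Σ`-power order modulo every `Σ`-index normal subgroup of `Δ`, then
`ι ∘ inl : Δ → closure ι(inl Δ)` is a pro-`Σ` completion of `Δ` (part IV `closure_map_of_cofinal` through
`Δ ≃* inl(Δ)`). [cite: MochizukiSemiAnbd2006, Ex. 2.10 p.31] -/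
theorem isProSigmaCompletion_closure_inl {ι : (Δ ⋊[φ] Multiplicative ℤ) →* P} (hι : IsProSigmaCompletion Sigma ι)
    (hφ : ∀ N : Subgroup Δ, N.Normal → IsSigmaInteger Sigma N.index →
      ∃ m : ℕ, IsSigmaInteger Sigma m ∧ ∀ x, (φ (Multiplicative.ofAdd (m : ℤ))) x * x⁻¹ ∈ N) :
    IsProSigmaCompletion Sigma
      (((Subgroup.inclusion (Subgroup.le_topologicalClosure
        ((SemidirectProduct.inl : Δ →* Δ ⋊[φ] Multiplicative ℤ).range.map ι))).comp
        (ι.subgroupMap (SemidirectProduct.inl : Δ →* Δ ⋊[φ] Multiplicative ℤ).range)).comp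
        (MonoidHom.ofInjective (SemidirectProduct.inl_injective (φ := φ))).toMonoidHom) := by
  set e : Δ ≃* ↥(SemidirectProduct.inl : Δ →* Δ ⋊[φ] Multiplicative ℤ).range :=
    MonoidHom.ofInjective (SemidirectProduct.inl_injective (φ := φ)) with he
  have hcof : ∀ N' : Subgroup ↥(SemidirectProduct.inl : Δ →* Δ ⋊[φ] Multiplicative ℤ).range, N'.Normal →
      IsSigmaInteger Sigma N'.index → ∃ M : Subgroup (Δ ⋊[φ] Multiplicative ℤ), M.Normal ∧
        IsSigmaInteger Sigma M.index ∧ M.subgroupOf _ ≤ N' := by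
    intro N' hN'n hN'i
    haveI := hN'n
    haveI : (N'.comap e.toMonoidHom).Normal := Subgroup.normal_comap _
    have hidx : IsSigmaInteger Sigma (N'.comap e.toMonoidHom).index := by
      rwa [Subgroup.index_comap_of_surjective N' (f := e.toMonoidHom) e.surjective]
    obtain ⟨M, hMn, hMi, hMN⟩ := exists_normal_sigma_trace φ hφ (N'.comap e.toMonoidHom) hidx
    refine ⟨M, hMn, hMi, fun x hx => ?_⟩
    have hx' : (e.symm x : Δ) ∈ M.comap SemidirectProduct.inl := by
      rw [Subgroup.mem_comap]
      have : (SemidirectProduct.inl (e.symm x) : Δ ⋊[φ] Multiplicative ℤ) = (x : Δ ⋊[φ] Multiplicative ℤ) := by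
        rw [← MonoidHom.ofInjective_apply (SemidirectProduct.inl_injective (φ := φ)), ← he,
          MulEquiv.apply_symm_apply]
      rw [this]
      exact Subgroup.mem_subgroupOf.mp hx
    have := hMN hx'
    rw [Subgroup.mem_comap] at this
    simpa using this
  exact of_comp_mulEquiv e (fun _ => rfl) (closure_map_of_cofinal hι _ hcof)

/-! ### The section `inr : ℤ → Δ ⋊_φ ℤ`: cofinality is unconditional -/

/-- **Cofinal `Σ`-traces for the section of `Δ ⋊_φ ℤ`.**  Every subgroup `N ≤ ℤ` of `Σ`-integer index is
`inr⁻¹(M)` for the normal subgroup `M = rightHom⁻¹(N) ⊴ Δ ⋊_φ ℤ`, of the same (`Σ`-integer) index.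
[cite: MochizukiSemiAnbd2006, Ex. 2.10 p.31] -/
theorem exists_normal_sigma_trace_inr (N : Subgroup (Multiplicative ℤ)) (hN : IsSigmaInteger Sigma N.index) :
    ∃ M : Subgroup (Δ ⋊[φ] Multiplicative ℤ), M.Normal ∧ IsSigmaInteger Sigma M.index ∧
      M.comap SemidirectProduct.inr ≤ N := by
  refine ⟨N.comap SemidirectProduct.rightHom, Subgroup.Normal.comap inferInstance _, ?_, fun z hz => ?_⟩
  · rw [Subgroup.index_comap_of_surjective N SemidirectProduct.rightHom_surjective]
    exact hN
  · rw [Subgroup.mem_comap, Subgroup.mem_comap, SemidirectProduct.rightHom_inr] at hz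
    exact hz

/-- **The section of `Δ ⋊_φ ℤ` is pro-`Σ` completed by closure**: for every pro-`Σ` completion
`ι : Δ ⋊_φ ℤ → P` with profinite target, `ι ∘ inr : ℤ → closure ι(inr ℤ)` is a pro-`Σ` completion of `ℤ` (part IV
`closure_map_of_cofinal` through `ℤ ≃* inr(ℤ)`). [cite: MochizukiSemiAnbd2006, Ex. 2.10 p.31] -/
theorem isProSigmaCompletion_closure_inr {ι : (Δ ⋊[φ] Multiplicative ℤ) →* P} (hι : IsProSigmaCompletion Sigma ι) :
    IsProSigmaCompletion Sigma
      (((Subgroup.inclusion (Subgroup.le_topologicalClosure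
        ((SemidirectProduct.inr : Multiplicative ℤ →* Δ ⋊[φ] Multiplicative ℤ).range.map ι))).comp
        (ι.subgroupMap (SemidirectProduct.inr : Multiplicative ℤ →* Δ ⋊[φ] Multiplicative ℤ).range)).comp
        (MonoidHom.ofInjective (SemidirectProduct.inr_injective (φ := φ))).toMonoidHom) := by
  set e : Multiplicative ℤ ≃* ↥(SemidirectProduct.inr : Multiplicative ℤ →* Δ ⋊[φ] Multiplicative ℤ).range :=
    MonoidHom.ofInjective (SemidirectProduct.inr_injective (φ := φ)) with he
  have hcof : ∀ N' : Subgroup ↥(SemidirectProduct.inr : Multiplicative ℤ →* Δ ⋊[φ] Multiplicative ℤ).range,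
      N'.Normal → IsSigmaInteger Sigma N'.index → ∃ M : Subgroup (Δ ⋊[φ] Multiplicative ℤ), M.Normal ∧
        IsSigmaInteger Sigma M.index ∧ M.subgroupOf _ ≤ N' := by
    intro N' _ hN'i
    have hidx : IsSigmaInteger Sigma (N'.comap e.toMonoidHom).index := by
      rwa [Subgroup.index_comap_of_surjective N' (f := e.toMonoidHom) e.surjective]
    obtain ⟨M, hMn, hMi, hMN⟩ := exists_normal_sigma_trace_inr φ (N'.comap e.toMonoidHom) hidx
    refine ⟨M, hMn, hMi, fun x hx => ?_⟩
    have hx' : (e.symm x : Multiplicative ℤ) ∈ M.comap SemidirectProduct.inr := by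
      rw [Subgroup.mem_comap]
      have : (SemidirectProduct.inr (e.symm x) : Δ ⋊[φ] Multiplicative ℤ) = (x : Δ ⋊[φ] Multiplicative ℤ) := by
        rw [← MonoidHom.ofInjective_apply (SemidirectProduct.inr_injective (φ := φ)), ← he,
          MulEquiv.apply_symm_apply]
      rw [this]
      exact Subgroup.mem_subgroupOf.mp hx
    have := hMN hx'
    rw [Subgroup.mem_comap] at this
    simpa using this
  exact of_comp_mulEquiv e (fun _ => rfl) (closure_map_of_cofinal hι _ hcof)

end SemidirectCofinal

end Literature.AnabelianGeometry.SemiGraphs.SemiGraphOfAnabelioids.IsProSigmaCompletion
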